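import Literature.AlgebraicGeometry.Resolution.CurveCentreNearPointUnique
import Literature.AlgebraicGeometry.Resolution.CurveCentreTwoParameters
import Literature.AlgebraicGeometry.Resolution.RegularBlowup
import Literature.AlgebraicGeometry.Resolution.PointBlowupHsFunMono
import HarnessLib

/-!
# [CoP1] Lemma 4.3 (4), the curve `Γ′` over a curve centre: nearness along `Γ′`, `π(Γ′) = Y`, and the
# reduction of its regularity to the quotient stalks `𝒪_{X′,z}/𝔭_{η′}` (helpers for the F-71 stub T2b′)

Topic: `Literature/AlgebraicGeometry/Resolution`. [CoP1] = Cossart–Piltant, J. Algebra 320 (2008), Lemma 4.3 (4)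
[p. 9 L42–43]: "If `Γ′` is the one-dimensional component of `Σ′ ∩ q⁻¹(Y)`, then `Γ′` is either empty or a regular
irreducible curve projecting isomorphically to `Y` by `q`."  In the currency of the F-71 skeleton (cell res-hironaka,
`candidates/F71_T1_T4_SIGNATURES.lean`, stub `stub_T2b'_isRegular_gammaPrime`): `π : X′ → X` the blowing up of the
regular locally Noetherian `X` along the regular irreducible centre `Y ⊆ {ord J = μ}`, `η′` a NEAR point over the generic
point of `Y`, `Γ′ := cl{η′}`.  This file PROVES, fact-free:

* `IsBlowup.isNear_of_specializes_of_isNear_curve` / `IsBlowup.forall_isNear_of_mem_closure_of_isNear_curve` — **every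
  point of `Γ′` is near** (clause 2 of the stub): for a specialization `η′ ⤳ z`, `π z ∈ Y`, so `ord_z J′ ≤ μ`
  (`IsBlowup.idealOrder_controlledTransform_le_of_mem`), and orders do not decrease under specialization on the regular
  `X′` (`idealOrder_le_of_specializes`, `IsBlowup.isRegular_of_isRegular_subscheme`);
* `IsBlowup.image_closure_singleton_eq` — **`π(Γ′) = Y`** (clause 3): `π` is proper (`IsBlowup.isProper`), hence closed;
* `isRegular_subscheme_vanishingIdeal_closure_of_forall` — clause 1 (regularity of `Γ′` with its reduced structure)
  REDUCED to the local rings: it suffices that `𝒪_{X′,z}/𝔭_{η′}` is a regular local ring for every `η′ ⤳ z`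
  (`isRegularLocalRing_stalk_subscheme_iff`, `stalkIdeal_vanishingIdeal_closure`); and the case `z = η′`
  (`isRegularLocalRing_stalk_quotient_primeOfSpecializes_self`: the quotient is the residue field);
* `IsBlowup.apply_ne_of_specializes_of_isNear_curve` — a point `z ≠ η′` of `Γ′` does not lie over `π η′`
  (uniqueness of near points over a point of the centre, `IsBlowup.eq_of_isNear_of_isNear_curve`, p613580);
* `IsBlowup.isRegular_gammaPrime_of_forall_quotient` — the stub's three clauses MODULO the one remaining local statement
  (regularity of `𝒪_{X′,z}/𝔭_{η′}` at the points `z ≠ η′` of `Γ′`), binders of `stub_T2b'_isRegular_gammaPrime` verbatim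
  plus that hypothesis.

What is NOT here: the regularity of `𝒪_{X′,z}/𝔭_{η′}` at the points `z ≠ η′` of `Γ′` (the chart computation
`𝔭_{η′} = (y₁, y₂/y₁ − a)` of [CoP1] p. 10 L11–12 / the finite-birational-onto-normal argument) — the remaining content
of the stub.  [OURS plumbing for cell res-hironaka W4.5a crux F-71; prover res-inputs-p-6.]  NOT a statement of any
manuscript under review (Hironaka 2017).  AI-written; weaker than expert review.

## Sources
* V. Cossart, O. Piltant, J. Algebra 320 (2008), Lemma 4.3 (4) [p. 9 L42–43], proof of Prop. 4.4 [p. 10 L11–12].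
  [CossartPiltant2008]
-/

noncomputable section

open CategoryTheory AlgebraicGeometry TopologicalSpace IsLocalRing

namespace Literature.AlgebraicGeometry.Resolution

universe u

open Scheme.IdealSheafData

variable {X X' : Scheme.{u}} {π : X' ⟶ X}

/-! ## Clause 3: `π(Γ′) = Y` -/

/-- **`π(cl{η′}) = Y`** for a blowing up `π` (proper, hence a closed map) and a point `η′` with `cl{π η′} = Y`.
[cite: CossartPiltant2008, Lemma 4.3 (4)] -/
theorem IsBlowup.image_closure_singleton_eq [IsLocallyNoetherian X] {I : X.IdealSheafData}
    (hπ : IsBlowup π I) {Y : Set X} {η' : X'} (hη' : closure {π η'} = Y) :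
    π '' closure ({η'} : Set X') = Y := by
  haveI : IsProper π := hπ.isProper
  apply le_antisymm
  · rw [← hη', ← Set.image_singleton]
    exact image_closure_subset_closure_image π.continuous
  · rw [← hη', ← Set.image_singleton]
    exact π.isClosedMap.closure_image_subset _

/-! ## Clause 2: every point of `Γ′` is near -/

/-- **Nearness propagates to specializations over the centre.** `X` regular locally Noetherian, `π` the blowing up
along the regular centre `Y ⊆ {ord J = μ}`, `η′` near with `π η′ ∈ Y`; then every specialization `z` of `η′` is near:
`μ = ord_{η′} J′ ≤ ord_z J′ ≤ μ`. [cite: CossartPiltant2008, Lemma 4.3 (4)] -/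
theorem IsBlowup.isNear_of_specializes_of_isNear_curve [IsLocallyNoetherian X] [IsLocallyNoetherian X']
    (hX : Scheme.IsRegular X) {Y : Closeds X} (hreg : Scheme.IsRegular (vanishingIdeal Y).subscheme)
    (hπ : IsBlowup π (vanishingIdeal Y)) {J : X.IdealSheafData} {μ : ℕ}
    (hY : ∀ y ∈ (Y : Set X), idealOrder J y = μ) {η' z : X'} (hη'Y : π η' ∈ (Y : Set X))
    (hsp : η' ⤳ z) (hnear : IsNear π (vanishingIdeal Y) J μ η') :
    IsNear π (vanishingIdeal Y) J μ z := by
  haveI : IsRegularLocalRing (X'.presheaf.stalk z) := hπ.isRegular_of_isRegular_subscheme hX hreg z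
  have hzY : π z ∈ (Y : Set X) := (hsp.map π.continuous).mem_closed Y.isClosed hη'Y
  have hle : idealOrder (controlledTransform π (vanishingIdeal Y) J μ) z ≤ μ :=
    hπ.idealOrder_controlledTransform_le_of_mem hX hreg hY hzY
  have hge : (μ : ℕ∞) ≤ idealOrder (controlledTransform π (vanishingIdeal Y) J μ) z :=
    (isNear_iff.mp hnear).ge.trans (idealOrder_le_of_specializes hsp _)
  exact isNear_iff.mpr (le_antisymm hle hge)

/-- **Every point of `Γ′ = cl{η′}` is near** (clause 2 of T2b′), for `η′` near over a point of `Y` — in particular over the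
generic point of `Y` (`cl{π η′} = Y`). [cite: CossartPiltant2008, Lemma 4.3 (4)] -/
theorem IsBlowup.forall_isNear_of_mem_closure_of_isNear_curve [IsLocallyNoetherian X]
    [IsLocallyNoetherian X'] (hX : Scheme.IsRegular X) {Y : Closeds X}
    (hreg : Scheme.IsRegular (vanishingIdeal Y).subscheme) (hπ : IsBlowup π (vanishingIdeal Y))
    {J : X.IdealSheafData} {μ : ℕ} (hY : ∀ y ∈ (Y : Set X), idealOrder J y = μ) {η' : X'}
    (hη' : closure {π η'} = (Y : Set X)) (hnear : IsNear π (vanishingIdeal Y) J μ η') :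
    ∀ z ∈ closure ({η'} : Set X'), IsNear π (vanishingIdeal Y) J μ z := fun _ hz =>
  hπ.isNear_of_specializes_of_isNear_curve hX hreg hY (hη' ▸ subset_closure rfl)
    (specializes_iff_mem_closure.mpr hz) hnear

/-! ## Clause 1, reduced to the quotient stalks -/

/-- **Regularity of the reduced closed subscheme `cl{η′}` is a statement about the quotients `𝒪_{X,z}/𝔭_{η′}`**:
if `𝒪_{X,z}/𝔭_{η′}` is a regular local ring for every specialization `η′ ⤳ z`, then `V(𝓘_{cl{η′}})` is regular
(its local ring at `z` is that quotient: `isRegularLocalRing_stalk_subscheme_iff`, `stalkIdeal_vanishingIdeal_closure` —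
the points of `cl{η′}` through `z` are the primes of `𝒪_{X,z}` above `𝔭_{η′}`, Stacks 01J7).
[cite: StacksProject, Tag 01J7] -/
theorem isRegular_subscheme_vanishingIdeal_closure_of_forall {η' : X'}
    (h : ∀ (z : X') (hz : η' ⤳ z), IsRegularLocalRing (X'.presheaf.stalk z ⧸ primeOfSpecializes hz)) :
    Scheme.IsRegular (vanishingIdeal (⟨closure {η'}, isClosed_closure⟩ : Closeds X')).subscheme := by
  intro s
  rw [isRegularLocalRing_stalk_subscheme_iff]
  have hz : η' ⤳ (vanishingIdeal (⟨closure {η'}, isClosed_closure⟩ : Closeds X')).subschemeι.base s := by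
    rw [specializes_iff_mem_closure]
    have hmem : (vanishingIdeal (⟨closure {η'}, isClosed_closure⟩ : Closeds X')).subschemeι.base s ∈
        ((vanishingIdeal (⟨closure {η'}, isClosed_closure⟩ : Closeds X')).support : Set X') := by
      rw [← Scheme.IdealSheafData.range_subschemeι]
      exact ⟨s, rfl⟩
    rwa [coe_support_vanishingIdeal] at hmem
  rw [stalkIdeal_vanishingIdeal_closure hz]
  exact h _ hz

/-- **At the generic point `η′` itself `𝒪_{X,η′}/𝔭_{η′}` is the residue field** (`𝔭_{η′} ⊆ 𝒪_{X,η′}` is the maximal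
ideal, Stacks 01J7), a regular local ring (a field). [cite: StacksProject, Tag 01J7] -/
theorem isRegularLocalRing_stalk_quotient_primeOfSpecializes_self (η' : X') :
    IsRegularLocalRing (X'.presheaf.stalk η' ⧸ primeOfSpecializes (specializes_refl η')) := by
  have hmax : primeOfSpecializes (specializes_refl η') = maximalIdeal (X'.presheaf.stalk η') := by
    rw [← stalkIdeal_primeDivisorIdeal (specializes_refl η'), stalkIdeal_primeDivisorIdeal_self]
  rw [hmax]
  letI : Field (X'.presheaf.stalk η' ⧸ maximalIdeal (X'.presheaf.stalk η')) :=
    Ideal.Quotient.field (maximalIdeal (X'.presheaf.stalk η'))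
  infer_instance

/-! ## The points of `Γ′` other than `η′` do not lie over the generic point of `Y` -/

/-- **A point `z ≠ η′` of `Γ′` is not over `π η′`** when `η′` is near over a point of `Y` at which `𝓘_Y` is generated by a
pair that is part of a regular system of parameters (e.g. the generic point of the curve `Y`): both would be near points
over the same point, contradicting the uniqueness of near points ([CoP1] Lemma 4.3 (4),
`IsBlowup.eq_of_isNear_of_isNear_curve`). [cite: CossartPiltant2008, Lemma 4.3 (4)] -/
theorem IsBlowup.apply_ne_of_specializes_of_isNear_curve [IsLocallyNoetherian X] [IsLocallyNoetherian X']
    (hX : Scheme.IsRegular X) {Y : Closeds X} (hreg : Scheme.IsRegular (vanishingIdeal Y).subscheme)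
    (hπ : IsBlowup π (vanishingIdeal Y)) {J : X.IdealSheafData} {μ : ℕ} (hμ : 1 ≤ μ)
    (hY : ∀ y ∈ (Y : Set X), idealOrder J y = μ) {η' z : X'}
    [IsRegularLocalRing (X.presheaf.stalk (π η'))]
    {c : Fin 2 → X.presheaf.stalk (π η')} (hcr : IsRsopPart c)
    (hcY : Ideal.span (Set.range c) = stalkIdeal (vanishingIdeal Y) (π η'))
    (hsp : η' ⤳ z) (hne : z ≠ η') (hnear : IsNear π (vanishingIdeal Y) J μ η') :
    π z ≠ π η' := by
  intro he
  have hη'Y : π η' ∈ (Y : Set X) := by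
    rw [← coe_support_vanishingIdeal, SetLike.mem_coe, mem_support_iff_stalkIdeal_le, ← hcY]
    exact hcr.span_range_le_maximalIdeal
  have hz : IsNear π (vanishingIdeal Y) J μ z :=
    hπ.isNear_of_specializes_of_isNear_curve hX hreg hY hη'Y hsp hnear
  exact hne (hπ.eq_of_isNear_of_isNear_curve hX hreg hμ hY hcr hcY hnear hz he)

/-! ## T2b′ modulo the local statement at the points `z ≠ η′` -/

/-- **T2b′ ([CoP1] Lemma 4.3 (4), the curve `Γ′`) MODULO the regularity of the quotient stalks `𝒪_{X′,z}/𝔭_{η′}` at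
the points `z ≠ η′` of `Γ′ = cl{η′}`.** Binders of the F-71 stub `stub_T2b'_isRegular_gammaPrime` verbatim, plus
`hquot`; conclusion verbatim.  (`hYirr`, `hμ`, `hJ`, `hcodim` are not used by this reduction; they are what the
remaining local statement consumes.) [cite: CossartPiltant2008, Lemma 4.3 (4)] -/
theorem IsBlowup.isRegular_gammaPrime_of_forall_quotient [IsLocallyNoetherian X]
    [IsLocallyNoetherian X'] (hX : Scheme.IsRegular X) {Y : Closeds X}
    (_hYirr : IsIrreducible ((Y : Closeds X) : Set X))
    (hreg : Scheme.IsRegular (vanishingIdeal Y).subscheme) (hπ : IsBlowup π (vanishingIdeal Y))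
    {J : X.IdealSheafData} {μ : ℕ} (_hμ : 1 ≤ μ) (hY : ∀ y ∈ (Y : Set X), idealOrder J y = μ)
    (_hJ : ∀ x, idealOrder J x ≤ μ) {η' : X'} (hη' : closure {π η'} = (Y : Set X))
    (_hcodim : Order.coheight (π η') = 2) (hnear : IsNear π (vanishingIdeal Y) J μ η')
    (hquot : ∀ (z : X') (hz : η' ⤳ z), z ≠ η' →
      IsRegularLocalRing (X'.presheaf.stalk z ⧸ primeOfSpecializes hz)) :
    Scheme.IsRegular (vanishingIdeal (⟨closure {η'}, isClosed_closure⟩ : Closeds X')).subscheme ∧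
      (∀ z ∈ closure ({η'} : Set X'), IsNear π (vanishingIdeal Y) J μ z) ∧
      π '' closure ({η'} : Set X') = (Y : Set X) := by
  refine ⟨isRegular_subscheme_vanishingIdeal_closure_of_forall fun z hz => ?_,
    hπ.forall_isNear_of_mem_closure_of_isNear_curve hX hreg hY hη' hnear,
    hπ.image_closure_singleton_eq hη'⟩
  by_cases hne : z = η'
  · subst hne
    exact isRegularLocalRing_stalk_quotient_primeOfSpecializes_self z
  · exact hquot z hz hne

end Literature.AlgebraicGeometry.Resolution

end
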